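import Literature.NumberTheory.LFunctions.QuasiRHFacts
import Literature.NumberTheory.LFunctions.MertensBoundRH
import Literature.NumberTheory.LFunctions.QuasiRHInvZetaBound
import HarnessLib

/-!
# Quasi-RH(`θ`) ⇒ `M(x) = O(x^{θ+ε})`: discharge of `Literature.NumberTheory.LFunctions.mertens_isBigO_of_quasiRiemannHypothesis`

Topic: `Literature/NumberTheory/LFunctions`. Proof file for the named fact
`Literature.NumberTheory.LFunctions.mertens_isBigO_of_quasiRiemannHypothesis` of `QuasiRHFacts.lean` (Littlewood 1912;
Titchmarsh, *The Theory of the Riemann Zeta-Function*, 2nd ed. (1986), Thm. 14.25 (A) ⇒ (C),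
p. 272, printed for `θ = 1/2`): if `ζ(s) ≠ 0` for `θ < Re s < 1` (`1/2 ≤ θ < 1`), then
`M(x) = ∑_{n ≤ x} μ(n) = O_ε(x^{θ+ε})` for every `ε > 0`.

The printed proof (§14.25) applies Perron's formula to `1/ζ(w) x^w/w` on `[2−iT, 2+iT]`, moves
the contour to `Re w = 1/2 + δ` and bounds the three sides "by (14.2.6)" (`1/ζ = O(t^ε)` on
`σ > 1/2`, Thm. 14.2); for a zero-free half-plane `σ > θ` the argument is verbatim with `1/2`
replaced by `θ`. The tree already runs this argument for `θ = 1/2` with a smoothed Perron kernel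
(`MertensBoundRH.lean`: `Literature.NumberTheory.LFunctions.MertensBoundRH.mertens_isBigO_of_riemannHypothesis`); the present
file re-runs its RH-dependent steps under `QuasiRiemannHypothesis θ`:

* `zetaInv = 1/ζ` (pole at `1` filled in by `0`) is holomorphic on `Re s > θ`
  (`differentiableOn_zetaInv`), and the analogue of (14.2.6) under quasi-RH(`θ`)
  (`QuasiRHInvZetaBound.lean`, `Literature.NumberTheory.LFunctions.InvZetaQuasiRH.norm_inv_riemannZeta_le_rpow`) plus
  compactness and `∑ n^{-2}` give `‖zetaInv(σ+it)‖ ≤ K(1+|t|)^ε` uniformly on `σ ≥ σ₀ > θ`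
  (`exists_bound_zetaInv`).
* The smoothed Perron formula on `Re s = 2` (`MertensBoundRH.integral_Fint_two`), the line shift
  to `Re s = c' = θ + ε'` (`integral_Fint_eq_two`, Cauchy on rectangles with `T → ∞`,
  `MertensBoundRH.integral_vertical_eq_of_tendsto`), the bound
  `‖∫ F(c'+it) dt‖ ≤ C x^{c'} h^{-2ε'}` (`MertensBoundRH.norm_integral_Fint_le`) and
  `|M(x) − ∑ μ(n)φ_h(n/x)| ≤ xh + 1` with `h = x^{-1/2}` give `M(x) = O(x^{θ+2ε'})`
  (`mertens_isBigO_of_quasiRH`).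

## Main results

* `Literature.NumberTheory.LFunctions.MertensBoundQuasiRH.exists_bound_zetaInv` — uniform `‖ζ⁻¹(σ+it)‖ ≤ K(1+|t|)^ε` on
  `σ ≥ σ₀ > θ` under quasi-RH(`θ`).
* `Literature.NumberTheory.LFunctions.MertensBoundQuasiRH.mertens_isBigO_of_quasiRH` — quasi-RH(`θ`), `1/2 ≤ θ < 1` ⇒
  `M(x) = O(x^{θ+ε})`.
* `Literature.NumberTheory.LFunctions.mertens_isBigO_of_quasiRiemannHypothesis_holds` — **discharge** of the named fact
  `Literature.NumberTheory.LFunctions.mertens_isBigO_of_quasiRiemannHypothesis` (`QuasiRHFacts.lean`).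
* `Literature.NumberTheory.LFunctions.mertens_isBigO_iff_forall_quasiRiemannHypothesis` — the unconditional form of
  `mertens_isBigO_iff_of_facts`: for `1/2 ≤ θ < 1`,
  `(∀ ε > 0, M(x) = O(x^{θ+ε})) ↔ ∀ θ' ∈ (θ, 1), QuasiRiemannHypothesis θ'`.

## References

* E. C. Titchmarsh, *The Theory of the Riemann Zeta-Function*, 2nd ed. revised by
  D. R. Heath-Brown, Oxford 1986: Thm. 14.25 (C) and its proof (§14.25, p. 272); Thm. 14.2,
  (14.2.6) (§14.2, pp. 247–248).
* J. E. Littlewood, *Quelques conséquences de l'hypothèse que la fonction ζ(s) n'a pas de zéros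
  dans le demi-plan Re(s) > 1/2*, C. R. Acad. Sci. Paris 154 (1912), 263–266.
* H. M. Edwards, *Riemann's Zeta Function* (1974), §12.1.
-/

noncomputable section

open Complex Filter Topology Asymptotics MeasureTheory Set
open scoped Real

namespace Literature.NumberTheory.LFunctions

namespace MertensBoundQuasiRH

open MertensBoundRH

variable {θ : ℝ}

/-! ## `zetaInv` under quasi-RH(`θ`) -/

/-- Under quasi-RH(`θ`), `zetaInv` is differentiable at every `s ≠ 1` with `Re s > θ`.
[folklore] -/
lemma differentiableAt_zetaInv_of_ne_one (hQ : QuasiRiemannHypothesis θ) {s : ℂ} (hs : θ < s.re)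
    (h1 : s ≠ 1) : DifferentiableAt ℂ zetaInv s := by
  have heq : zetaInv =ᶠ[𝓝 s] fun z => (riemannZeta z)⁻¹ := by
    filter_upwards [isOpen_compl_singleton.mem_nhds h1] with z hz
    exact zetaInv_of_ne_one hz
  refine DifferentiableAt.congr_of_eventuallyEq ?_ heq
  exact (differentiableAt_riemannZeta h1).inv (InvZetaQuasiRH.riemannZeta_ne_zero_of_quasiRH hQ hs)

/-- Under quasi-RH(`θ`), `zetaInv` is holomorphic on `Re s > θ` (removable singularity at `1`).
[folklore] -/
lemma differentiableOn_zetaInv (hQ : QuasiRiemannHypothesis θ) :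
    DifferentiableOn ℂ zetaInv {s : ℂ | θ < s.re} := by
  intro s hs
  simp only [Set.mem_setOf_eq] at hs
  refine DifferentiableAt.differentiableWithinAt ?_
  by_cases h1 : s = 1
  · subst h1
    refine (Complex.analyticAt_of_differentiable_on_punctured_nhds_of_continuousAt ?_
      continuousAt_zetaInv_one).differentiableAt
    have hopen : IsOpen {z : ℂ | θ < z.re} := isOpen_lt continuous_const Complex.continuous_re
    filter_upwards [self_mem_nhdsWithin, mem_nhdsWithin_of_mem_nhds (hopen.mem_nhds hs)]
      with z hz1 hz
    exact differentiableAt_zetaInv_of_ne_one hQ hz hz1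
  · exact differentiableAt_zetaInv_of_ne_one hQ hs h1

/-- Under quasi-RH(`θ`), `zetaInv` is continuous on `Re s > θ`. [folklore] -/
lemma continuousOn_zetaInv (hQ : QuasiRiemannHypothesis θ) :
    ContinuousOn zetaInv {s : ℂ | θ < s.re} :=
  (differentiableOn_zetaInv hQ).continuousOn

/-- Uniform polynomially-small bound for `zetaInv` under quasi-RH(`θ`) (`1/2 ≤ θ < 1`), all `t`:
for `σ₀ > θ` and `ε > 0` there is `K` with `‖zetaInv(σ+it)‖ ≤ K (1+|t|)^ε` for all `σ ≥ σ₀` and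
all real `t`. Large `|t|`: the analogue of Titchmarsh (14.2.6) under quasi-RH
(`InvZetaQuasiRH.norm_inv_riemannZeta_le_rpow`); `|t| ≤ T₁`, `σ ≤ 2`: continuity of `zetaInv` on
a compact rectangle; `σ ≥ 2`: `∑ n^{-2}`. [cite: Titchmarsh1986, Thm 14.2, eq. (14.2.6)] -/
theorem exists_bound_zetaInv (hQ : QuasiRiemannHypothesis θ) (hθ : 1 / 2 ≤ θ) (hθ1 : θ < 1)
    {σ₀ : ℝ} (hσ₀ : θ < σ₀) {ε : ℝ} (hε : 0 < ε) :
    ∃ K : ℝ, 0 < K ∧ ∀ σ t : ℝ, σ₀ ≤ σ → ‖zetaInv (σ + t * I)‖ ≤ K * (1 + |t|) ^ ε := by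
  obtain ⟨T, hT⟩ := InvZetaQuasiRH.norm_inv_riemannZeta_le_rpow hQ hθ hθ1 hσ₀ hε
  -- large `|t|`
  set T₁ : ℝ := max T 1 with hT₁def
  have hlarge : ∀ σ t : ℝ, σ₀ ≤ σ → T₁ ≤ |t| → ‖zetaInv (σ + t * I)‖ ≤ (1 + |t|) ^ ε := by
    intro σ t hσ ht
    have ht1 : 1 ≤ |t| := le_trans (le_max_right _ _) ht
    have htT : T ≤ |t| := le_trans (le_max_left _ _) ht
    have hne : (σ : ℂ) + t * I ≠ 1 := by
      intro h
      have := congrArg Complex.im h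
      simp at this
      simp [this] at ht1
      exact absurd ht1 (by norm_num)
    rw [zetaInv_of_ne_one hne]
    refine (hT σ t hσ htT).trans ?_
    exact Real.rpow_le_rpow (abs_nonneg t) (by linarith) hε.le
  -- compact part
  set R : Set ℂ := Set.Icc σ₀ 2 ×ℂ Set.Icc (-T₁) T₁ with hR
  have hRc : IsCompact R := isCompact_Icc.reProdIm isCompact_Icc
  have hRsub : R ⊆ {s : ℂ | θ < s.re} := by
    intro s hs
    rw [hR, mem_reProdIm] at hs
    simp only [Set.mem_setOf_eq]
    linarith [hs.1.1]
  obtain ⟨B, hB⟩ := hRc.exists_bound_of_continuousOn ((continuousOn_zetaInv hQ).mono hRsub)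
  set Z : ℝ := ∑' n : ℕ, 1 / ((n : ℝ) + 1) ^ 2 with hZ
  refine ⟨max 1 (max B Z), lt_of_lt_of_le zero_lt_one (le_max_left _ _), fun σ t hσ => ?_⟩
  have hpow : 1 ≤ (1 + |t|) ^ ε := Real.one_le_rpow (by linarith [abs_nonneg t]) hε.le
  have hK1 : (1 : ℝ) ≤ max 1 (max B Z) := le_max_left _ _
  by_cases ht : T₁ ≤ |t|
  · calc ‖zetaInv (σ + t * I)‖ ≤ (1 + |t|) ^ ε := hlarge σ t hσ ht
      _ = 1 * (1 + |t|) ^ ε := (one_mul _).symm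
      _ ≤ max 1 (max B Z) * (1 + |t|) ^ ε := by gcongr
  by_cases hσ2 : 2 ≤ σ
  · calc ‖zetaInv (σ + t * I)‖ ≤ Z := norm_zetaInv_le_of_two_le (by simpa using hσ2)
      _ ≤ max 1 (max B Z) * 1 := by simp
      _ ≤ max 1 (max B Z) * (1 + |t|) ^ ε := by gcongr
  · have hmem : (σ : ℂ) + t * I ∈ R := by
      rw [hR, mem_reProdIm]
      constructor
      · simp only [add_re, ofReal_re, mul_re, I_re, mul_zero, ofReal_im, I_im, mul_one, sub_self,
          add_zero, Set.mem_Icc]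
        exact ⟨hσ, (not_le.mp hσ2).le⟩
      · simp only [add_im, ofReal_im, mul_im, ofReal_re, I_im, mul_one, I_re, mul_zero, add_zero,
          zero_add, Set.mem_Icc]
        exact abs_le.mp (not_le.mp ht).le
    calc ‖zetaInv (σ + t * I)‖ ≤ B := hB _ hmem
      _ ≤ max 1 (max B Z) * 1 := by simp
      _ ≤ max 1 (max B Z) * (1 + |t|) ^ ε := by gcongr

/-! ## The integrand `F_{h,x}(s) = Φ_h(s) x^s ζinv(s)` on `Re s > θ` -/

variable {h x : ℝ}

/-- Under quasi-RH(`θ`) (`θ ≥ 0`), the integrand `F_{h,x}` is differentiable at every `s` with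
`Re s > θ`. [folklore] -/
lemma differentiableAt_Fint (hQ : QuasiRiemannHypothesis θ) (hθ : 0 ≤ θ) (hh : h ≠ 0)
    (hx : 0 < x) {s : ℂ} (hs : θ < s.re) : DifferentiableAt ℂ (Fint h x) s := by
  have hs0 : s ≠ 0 := fun h0 => by rw [h0] at hs; simp at hs; linarith
  have hs1 : s + 1 ≠ 0 := fun h0 => by
    have := congrArg Complex.re h0; simp at this; linarith
  have hopen : IsOpen {z : ℂ | θ < z.re} := isOpen_lt continuous_const Complex.continuous_re
  have hζ : DifferentiableAt ℂ zetaInv s :=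
    (differentiableOn_zetaInv hQ).differentiableAt (hopen.mem_nhds hs)
  have hxs : DifferentiableAt ℂ (fun z : ℂ => (x : ℂ) ^ z) s :=
    differentiableAt_id.const_cpow (Or.inl (by exact_mod_cast hx.ne'))
  unfold Fint
  exact ((differentiableAt_Phi h hs0 hs1 hh).mul hxs).mul hζ

/-- Under quasi-RH(`θ`), `F_{h,x}` is holomorphic on `Re s > θ`. [folklore] -/
lemma differentiableOn_Fint (hQ : QuasiRiemannHypothesis θ) (hθ : 0 ≤ θ) (hh : h ≠ 0)
    (hx : 0 < x) : DifferentiableOn ℂ (Fint h x) {s : ℂ | θ < s.re} :=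
  fun _ hs => (differentiableAt_Fint hQ hθ hh hx hs).differentiableWithinAt

/-- Continuity of `t ↦ F_{h,x}(σ + it)` for `σ > θ` (under quasi-RH(`θ`)). [folklore] -/
lemma continuous_Fint_vertical (hQ : QuasiRiemannHypothesis θ) (hθ : 0 ≤ θ) (hh : h ≠ 0)
    (hx : 0 < x) {σ : ℝ} (hσ : θ < σ) : Continuous fun t : ℝ => Fint h x (σ + t * I) :=
  (differentiableOn_Fint hQ hθ hh hx).continuousOn.comp_continuous (by fun_prop)
    (fun t => by simpa using hσ)

/-- Integrability of `t ↦ F(σ+it)` (`θ < σ ≤ 2`, `σ₀ ≤ σ`, `ε < 1`), given a uniform bound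
`‖ζinv(σ+it)‖ ≤ K(1+|t|)^ε` on `σ ≥ σ₀`. [folklore] -/
lemma integrable_Fint_vertical (hQ : QuasiRiemannHypothesis θ) (hθ : 0 ≤ θ) (hh : 0 < h)
    (hh1 : h ≤ 1) (hx : 0 < x) {K ε σ₀ : ℝ} (hK0 : 0 ≤ K) (hε1 : ε < 1)
    (hK : ∀ σ t : ℝ, σ₀ ≤ σ → ‖zetaInv (σ + t * I)‖ ≤ K * (1 + |t|) ^ ε) {σ : ℝ} (hσ₀ : σ₀ ≤ σ)
    (hσ : θ < σ) (hσ2 : σ ≤ 2) : Integrable fun t : ℝ => Fint h x (σ + t * I) := by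
  have hσpos : 0 < σ := by linarith
  set C : ℝ := 9 / (h * min (σ ^ 2) 1) * 2 * x ^ σ * K with hC
  have hfin : (Module.finrank ℝ ℝ : ℝ) < 2 - ε := by simp; linarith
  refine Integrable.mono' ((integrable_one_add_norm hfin).const_mul C)
    (continuous_Fint_vertical hQ hθ hh.ne' hx hσ).aestronglyMeasurable
    (Eventually.of_forall fun t => ?_)
  refine (norm_Fint_le hx hK hσ₀ t).trans ?_
  have hΦ := norm_Phi_vertical_le hh hh1 hσpos hσ2 t
  have hu : 0 < 1 + |t| := by positivity
  have h2 : (1 + t ^ 2)⁻¹ ≤ 2 * (1 + |t|) ^ (-(2 : ℝ)) := by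
    rw [Real.rpow_neg hu.le, show ((1 + |t|) ^ (2 : ℝ) : ℝ) = (1 + |t|) ^ 2 by norm_num,
      ← div_eq_mul_inv, le_div_iff₀ (by positivity)]
    have : (1 + |t|) ^ 2 ≤ 2 * (1 + t ^ 2) := by
      have := sq_abs t; nlinarith [abs_nonneg t, sq_nonneg (|t| - 1)]
    calc (1 + t ^ 2)⁻¹ * (1 + |t|) ^ 2 ≤ (1 + t ^ 2)⁻¹ * (2 * (1 + t ^ 2)) := by gcongr
      _ = 2 := by field_simp
  have hm : 0 < min (σ ^ 2) 1 := lt_min (by positivity) one_pos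
  calc ‖Phi h (σ + t * I)‖ * x ^ σ * (K * (1 + |t|) ^ ε)
      ≤ (9 / (h * min (σ ^ 2) 1) * (1 + t ^ 2)⁻¹) * x ^ σ * (K * (1 + |t|) ^ ε) := by gcongr
    _ ≤ (9 / (h * min (σ ^ 2) 1) * (2 * (1 + |t|) ^ (-(2 : ℝ)))) * x ^ σ * (K * (1 + |t|) ^ ε) := by
        gcongr
    _ = C * ((1 + |t|) ^ (-(2 : ℝ)) * (1 + |t|) ^ ε) := by rw [hC]; ring
    _ = C * (1 + ‖t‖) ^ (-(2 - ε)) := by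
        rw [← Real.rpow_add hu, Real.norm_eq_abs]; congr 1; ring_nf

/-- **Line shift** for `F_{h,x}` from `Re s = 2` to `Re s = c'` (`θ < c' ≤ 2`), under
quasi-RH(`θ`) (`θ ≥ 0`) and a uniform bound `‖ζinv(σ+it)‖ ≤ K(1+|t|)^ε` on `σ ≥ c'` (`ε < 1`).
[folklore] -/
theorem integral_Fint_eq_two (hQ : QuasiRiemannHypothesis θ) (hθ : 0 ≤ θ) (hh : 0 < h)
    (hh1 : h ≤ 1) (hx : 1 ≤ x) {K ε c' : ℝ} (hK0 : 0 ≤ K) (hε1 : ε < 1) (hc' : θ < c')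
    (hc'2 : c' ≤ 2) (hK : ∀ σ t : ℝ, c' ≤ σ → ‖zetaInv (σ + t * I)‖ ≤ K * (1 + |t|) ^ ε) :
    ∫ t : ℝ, Fint h x (c' + t * I) = ∫ t : ℝ, Fint h x (2 + t * I) := by
  have hx0 : 0 < x := by linarith
  have hc'pos : 0 < c' := by linarith
  have h2 : ((2 : ℝ) : ℂ) = 2 := by norm_num
  have := integral_vertical_eq_of_tendsto (Fint h x) hc'2 ?_
    (integrable_Fint_vertical hQ hθ hh hh1 hx0 hK0 hε1 hK le_rfl hc' hc'2)
    (by simpa only [h2] using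
      integrable_Fint_vertical hQ hθ hh hh1 hx0 hK0 hε1 hK hc'2 (by linarith) le_rfl)
    (fun ε₀ hε₀ => decay_Fint hh hh1 hx hK0 hε1.le hK hc'pos hε₀)
  · simpa only [h2] using this
  · refine (differentiableOn_Fint hQ hθ hh.ne' hx0).mono fun z hz => ?_
    rw [mem_reProdIm] at hz
    simp only [Set.mem_setOf_eq]
    linarith [hz.1.1]

/-! ## Quasi-RH(`θ`) ⇒ `M(x) = O(x^{θ+ε})` -/

/-- **Quasi-RH(`θ`) ⇒ `M(x) = O(x^{θ+ε})`** (`1/2 ≤ θ < 1`; Littlewood 1912; Titchmarsh 1986,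
Thm. 14.25 (A) ⇒ (C), p. 272, printed for `θ = 1/2`: Perron's formula for `1/ζ`, contour moved
to `Re w = θ + δ`, sides bounded by (14.2.6)). Proof here: smoothed Perron formula
`∑ μ(n)φ_h(n/x) = (1/2πi)∫_{(2)} Φ_h(s) x^s/ζ(s) ds`, line shift to `Re s = θ + ε'` using the
analogue of (14.2.6) under quasi-RH (`exists_bound_zetaInv`), the bound
`‖Φ_h‖ ≤ 9h^{-2ε'}|s|^{-1-2ε'}`, and `h = x^{-1/2}` (`|M(x) − ∑ μ(n)φ_h(n/x)| ≤ √x + 1`).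
[cite: Titchmarsh1986, Thm 14.25 ((A) ⇒ (C))] -/
theorem mertens_isBigO_of_quasiRH (hQ : QuasiRiemannHypothesis θ) (hθ : 1 / 2 ≤ θ)
    (hθ1 : θ < 1) {ε : ℝ} (hε : 0 < ε) :
    (fun x : ℝ => (LFunctions.mertensFunction x : ℝ)) =O[atTop] fun x : ℝ => x ^ (θ + ε) := by
  -- parameters
  set ε' : ℝ := min (ε / 2) ((1 - θ) / 4) with hε'
  have hε'0 : 0 < ε' := lt_min (by linarith) (by linarith)
  have hε'1 : ε' ≤ (1 - θ) / 4 := min_le_right _ _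
  have hε'2 : ε' ≤ ε / 2 := min_le_left _ _
  have hε'3 : ε' ≤ 1 / 8 := by linarith
  set c' : ℝ := θ + ε' with hc'
  have hc'θ : θ < c' := by rw [hc']; linarith
  have hc'h : 1 / 2 < c' := by linarith
  have hc'1 : c' ≤ 1 := by rw [hc']; linarith
  obtain ⟨K, hK0, hK⟩ := exists_bound_zetaInv hQ hθ hθ1 hc'θ hε'0
  set J : ℝ := ∫ t : ℝ, (1 + ‖t‖) ^ (-(1 + ε')) with hJ
  set C₁ : ℝ := 9 * (2 / c') ^ 2 * K * J with hC₁
  have hJ0 : 0 ≤ J := integral_nonneg fun t => by positivity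
  have hC₁0 : 0 ≤ C₁ := by positivity
  refine IsBigO.of_bound (2 + C₁) ?_
  filter_upwards [eventually_ge_atTop (1 : ℝ)] with x hx
  have hx0 : 0 < x := by linarith
  -- the cutoff width
  set h : ℝ := x ^ (-(1 / 2 : ℝ)) with hhdef
  have hh : 0 < h := Real.rpow_pos_of_pos hx0 _
  have hh1 : h ≤ 1 := by
    rw [hhdef, Real.rpow_neg hx0.le]
    exact inv_le_one_of_one_le₀ (Real.one_le_rpow hx (by norm_num))
  -- the smoothed sum and its integral representation
  set S : ℂ := ∑' n : ℕ, (ArithmeticFunction.moebius n : ℂ) * (phi h (n / x) : ℂ) with hS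
  have hV2 : ∫ t : ℝ, Fint h x (2 + t * I) = 2 * π * S := integral_Fint_two hh hh1 hx0
  have hshift := integral_Fint_eq_two hQ (by linarith) hh hh1 hx hK0.le (by linarith) hc'θ
    (by linarith) hK
  have hbound := norm_integral_Fint_le hh hh1 hx0 hK0.le hε'0 (by linarith) hc'h hc'1 hK
  rw [hshift, hV2, ← hJ, ← hC₁] at hbound
  -- `‖S‖ ≤ C₁ x^{c'} h^{-2ε'} / (2π) ≤ C₁ x^{c'+ε'}`
  have hhpow : h ^ (-(2 * ε')) = x ^ ε' := by
    rw [hhdef, ← Real.rpow_mul hx0.le]; congr 1; ring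
  have hxc : x ^ c' * x ^ ε' = x ^ (c' + ε') := (Real.rpow_add hx0 _ _).symm
  have hS_le : ‖S‖ ≤ C₁ * x ^ (c' + ε') := by
    rw [norm_mul, show ‖(2 * π : ℂ)‖ = 2 * π by
      rw [norm_mul, Complex.norm_ofNat, Complex.norm_real, Real.norm_eq_abs,
        abs_of_pos Real.pi_pos]]
      at hbound
    rw [hhpow, mul_assoc C₁, hxc] at hbound
    have h2π : (1 : ℝ) ≤ 2 * π := by linarith [Real.pi_gt_three]
    have : ‖S‖ ≤ 2 * π * ‖S‖ := le_mul_of_one_le_left (norm_nonneg _) h2π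
    exact this.trans hbound
  -- combine with `‖M(x) − S‖ ≤ x h + 1 = √x + 1`
  have hMS := norm_mertens_sub_tsum_le hh hx
  have hxh : x * h = x ^ (1 / 2 : ℝ) := by
    rw [hhdef, Real.rpow_neg hx0.le]
    rw [show x * (x ^ (1 / 2 : ℝ))⁻¹ = x ^ (1 : ℝ) / x ^ (1 / 2 : ℝ) by rw [Real.rpow_one]; ring,
      ← Real.rpow_sub hx0]
    norm_num
  have hexp : c' + ε' ≤ θ + ε := by rw [hc']; linarith
  have hx1 : (1 : ℝ) ≤ x ^ (θ + ε) := Real.one_le_rpow hx (by linarith)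
  have hx2 : x ^ (1 / 2 : ℝ) ≤ x ^ (θ + ε) := Real.rpow_le_rpow_of_exponent_le hx (by linarith)
  have hx3 : x ^ (c' + ε') ≤ x ^ (θ + ε) := Real.rpow_le_rpow_of_exponent_le hx hexp
  rw [Real.norm_eq_abs, Real.norm_eq_abs, abs_of_nonneg (by positivity : (0 : ℝ) ≤ x ^ (θ + ε))]
  have hM : |(LFunctions.mertensFunction x : ℝ)| = ‖(LFunctions.mertensFunction x : ℂ)‖ := by
    rw [Complex.norm_intCast]
  rw [hM]
  calc ‖((LFunctions.mertensFunction x : ℤ) : ℂ)‖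
      ≤ ‖(LFunctions.mertensFunction x : ℂ) - S‖ + ‖S‖ := norm_le_norm_sub_add _ _
    _ ≤ (x * h + 1) + C₁ * x ^ (c' + ε') := add_le_add hMS hS_le
    _ = x ^ (1 / 2 : ℝ) + 1 + C₁ * x ^ (c' + ε') := by rw [hxh]
    _ ≤ x ^ (θ + ε) + x ^ (θ + ε) + C₁ * x ^ (θ + ε) := by gcongr
    _ = (2 + C₁) * x ^ (θ + ε) := by ring

end MertensBoundQuasiRH

/-- **Discharge of the named fact `mertens_isBigO_of_quasiRiemannHypothesis`**
(`QuasiRHFacts.lean`; Littlewood 1912; Titchmarsh 1986, Thm. 14.25 (A) ⇒ (C), p. 272, whose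
printed proof for `θ = 1/2` — Perron's formula for `1/ζ` and the bound (14.2.6)
`1/ζ(σ+it) = O(t^ε)` on `σ > 1/2` from Thm. 14.2 — is verbatim for a zero-free half-plane
`σ > θ`): if `ζ(s) ≠ 0` for `θ < Re s < 1` (`1/2 ≤ θ < 1`), then `M(x) = O_ε(x^{θ+ε})` for every
`ε > 0`. Proof: `MertensBoundQuasiRH.mertens_isBigO_of_quasiRH` (smoothed Perron + line shift,
this file) and `InvZetaQuasiRH.norm_inv_riemannZeta_le_rpow` (`QuasiRHInvZetaBound.lean`,
Borel–Carathéodory + three circles under quasi-RH).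
[cite: Titchmarsh1986, Thm 14.25 ((A) ⇒ (C))] -/
theorem mertens_isBigO_of_quasiRiemannHypothesis_holds :
    mertens_isBigO_of_quasiRiemannHypothesis :=
  fun _θ hθ hθ1 hQ _ε hε => MertensBoundQuasiRH.mertens_isBigO_of_quasiRH hQ hθ hθ1 hε

/-- The ladder equivalence of route `RiemannHypothesis/Strip` made unconditional: for
`1/2 ≤ θ < 1`, `M(x) = O_ε(x^{θ+ε})` for every `ε > 0` iff `ζ` has no zeros with `θ' < Re s < 1`
for every `θ' ∈ (θ, 1)` — `mertens_isBigO_iff_of_facts` fed with the two discharged facts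
`quasiRiemannHypothesis_of_mertens_isBigO_holds` (`LittlewoodCriterion.lean`) and
`mertens_isBigO_of_quasiRiemannHypothesis_holds`. [cite: Titchmarsh1986, Thm 14.25] -/
theorem mertens_isBigO_iff_forall_quasiRiemannHypothesis {θ : ℝ} (hθ : 1 / 2 ≤ θ)
    (hθ1 : θ < 1) :
    (∀ ε : ℝ, 0 < ε →
        (fun x : ℝ => (LFunctions.mertensFunction x : ℝ)) =O[atTop] fun x : ℝ => x ^ (θ + ε)) ↔
      ∀ θ' : ℝ, θ < θ' → θ' < 1 → QuasiRiemannHypothesis θ' :=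
  mertens_isBigO_iff_of_facts quasiRiemannHypothesis_of_mertens_isBigO_holds
    mertens_isBigO_of_quasiRiemannHypothesis_holds hθ hθ1

end Literature.NumberTheory.LFunctions

end
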